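import Mathlib
import Summits.AtomisticToContinuum.HydrodynamicLimit.Theorems.OneFlightGossipEngineSuperExponentialEnergyTailsDefsB
import HarnessLib

/-!
# Maximum principle and Desvillettes' polynomial moment bounds for the Gevrey induction
# (stub `stub_gevreyInduction`, line `Sketch`, crux `SuperExponentialEnergyTails`, stmt-AtomisticToContinuum-17701), stage 2/4

Pure real analysis over the hypothesis structure `MomentSystem` (support file `…SuperExponentialEnergyTailsDefsB`, §5):

* `gevreyMaxPrinciple` (registered stub): if `x` is continuous on `[0,t]`, `x 0 ≤ Y`, `x s' - x s ≤ ν ∫_s^{s'} F` on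
  every window and `F r ≤ 0` whenever `Y < x r`, then `x ≤ Y` on `[0,t]` — no integrability is needed (a
  non-integrable Bochner integral is `0`);
* Lyapunov consequences of `MomentSystem` (fields `lyapunov`, `mass_le`, `energy_le`, `nonneg`):
  `moment_le_interp` (`m_p ≤ E · max(1, m_{2k})^{(p-2)/(2k-2)}` for `2 ≤ p ≤ 2k`, `E = max E₁ 1`), `moment_le_max`,
  `moment_mul_moment_le` (a product of two moments of orders `p + p' = 2k+1`, `p, p' ≥ 2`, is `≤ E² max(1, m_{2k})`),
  `moment_mul_rpow_le_moment_succ` (the super-linear loss `m_{2k}^{1+1/(2k)} ≤ m_{2k+1}`, from `m_0 ≤ 1`),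
  `moment_odd_le_sqrt` (`m_{2i+1} ≤ √(m_{2i} m_{2i+2})`), `loss_lower` (the loss term for `γ_k ≤ 1/2`);
* `balance_integrand_le`: the Povzner balance integrand at order `k ≥ k₁` is at most
  `B_k E² max(1,y) + K₂ y - (K₁/2) y^{1+1/(2k)}`, `y = m_{2k}(r)`, `B_k = ∑_{0<j<k} C(k,j) C_G (1+min(j,k-j))^q`;
* `gevreyPolynomialBounds` (registered stub): an explicit `D : ℕ → ℝ` depending on the constants only with
  `m_{2k}(s) ≤ D k` for all `k ≤ n`, `s ∈ [0,t]` — the maximum principle at the level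
  `D₀ k = max (max 1 (C₀ A₀ᵏ k!)) ((2 (B_k E² + K₂)/K₁)^{2k})` for `k₁ ≤ k ≤ n`, interpolation against `m_{2k₁}` below `k₁`.

Reference for the method: L. Desvillettes, Arch. Rational Mech. Anal. 123 (1993) 387–404, §2 (polynomial moment
bounds for hard potentials); here in integral (maximum-principle) form, uniform in the horizon and in `ν`.

prover-line-stmt-AtomisticToContinuum-17701-0 (stub worker `stub_gevreyInduction`).
-/

noncomputable section

namespace Summit.AtomisticToContinuum.HydrodynamicLimit.Theorems.SuperExponentialEnergyTailsMaxPrinciple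

open scoped BigOperators
open MeasureTheory Set
open Summit.AtomisticToContinuum.HydrodynamicLimit.Theorems.SuperExponentialEnergyTailsLine (MomentSystem)

/-! ## §1 The maximum principle -/

/-- **Maximum principle for integral balance inequalities** (registered stub `gevreyMaxPrinciple`).  Let `x` be
continuous on `[0,t]` with `x 0 ≤ Y`, and suppose `x s' - x s ≤ ν ∫_s^{s'} F(r) dr` for all `0 ≤ s ≤ s' ≤ t` with
`ν ≥ 0`, where `F r ≤ 0` whenever `r ∈ [0,t]` and `Y < x r`.  Then `x s ≤ Y` on `[0,t]`.  Proof: if `Y < x s₁`, the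
last time `s₀ = sup {s ≤ s₁ : x s ≤ Y}` has `x s₀ ≤ Y` (closedness), `x > Y` on `(s₀, s₁]`, so the integral over
`(s₀, s₁]` is `≤ 0` (pointwise, no integrability needed) and `x s₁ ≤ x s₀ ≤ Y`. [folklore] -/
theorem gevreyMaxPrinciple : ∀ (t ν Y : ℝ) (x F : ℝ → ℝ), 0 ≤ ν → ContinuousOn x (Set.Icc 0 t) → x 0 ≤ Y → (∀ r ∈ Set.Icc 0 t, Y < x r → F r ≤ 0) → (∀ s s' : ℝ, 0 ≤ s → s ≤ s' → s' ≤ t → x s' - x s ≤ ν * ∫ r in s..s', F r) → ∀ s ∈ Set.Icc 0 t, x s ≤ Y := by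
  intro t ν Y x F hν hx h0 hF hbal s₁ hs₁
  by_contra hlt
  rw [not_le] at hlt
  set S : Set ℝ := Set.Icc 0 s₁ ∩ x ⁻¹' Set.Iic Y with hS
  have h0S : (0 : ℝ) ∈ S := ⟨⟨le_rfl, hs₁.1⟩, h0⟩
  have hSbdd : BddAbove S := ⟨s₁, fun s hs => hs.1.2⟩
  have hSclosed : IsClosed S :=
    (hx.mono (Set.Icc_subset_Icc le_rfl hs₁.2)).preimage_isClosed_of_isClosed isClosed_Icc isClosed_Iic
  obtain ⟨⟨hs₀0, hs₀le⟩, hxs₀⟩ := hSclosed.csSup_mem ⟨0, h0S⟩ hSbdd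
  have hxs₀' : x (sSup S) ≤ Y := hxs₀
  have hint : ∫ r in (sSup S)..s₁, F r ≤ 0 := by
    rw [intervalIntegral.integral_of_le hs₀le]
    refine MeasureTheory.setIntegral_nonpos measurableSet_Ioc fun r hr => ?_
    refine hF r ⟨hs₀0.trans hr.1.le, hr.2.trans hs₁.2⟩ ?_
    by_contra hle
    rw [not_lt] at hle
    have hrS : r ∈ S := ⟨⟨hs₀0.trans hr.1.le, hr.2⟩, hle⟩
    exact absurd (le_csSup hSbdd hrS) (not_le.mpr hr.1)
  have hb := hbal (sSup S) s₁ hs₀0 hs₀le hs₁.2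
  have hν' : ν * ∫ r in (sSup S)..s₁, F r ≤ 0 := mul_nonpos_of_nonneg_of_nonpos hν hint
  linarith

variable {t ν : ℝ} {n k₁ q : ℕ} {K₁ K₂ CG CSD E₁ C₀ A₀ : ℝ} {m : ℕ → ℝ → ℝ}

/-! ## §2 Lyapunov consequences -/

/-- **Interpolation between the energy and `m_{2k}`.**  For `2 ≤ p ≤ 2k` (`k ≥ 2`) and `s ∈ [0,t]`:
`m_p(s) ≤ E · W^{(p-2)/(2k-2)}` with `E = max E₁ 1`, `W = max 1 (m_{2k}(s))` (Lyapunov log-convexity between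
the orders `2` and `2k`, `m_2 ≤ E₁`). [folklore] -/
theorem moment_le_interp (hM : MomentSystem t ν n k₁ q K₁ K₂ CG CSD E₁ C₀ A₀ m) {k p : ℕ} (hk : 2 ≤ k)
    (hp : 2 ≤ p) (hpk : p ≤ 2 * k) {s : ℝ} (hs : s ∈ Set.Icc 0 t) :
    m p s ≤ max E₁ 1 * max 1 (m (2 * k) s) ^ (((p : ℝ) - 2) / (2 * k - 2)) := by
  have hE : 1 ≤ max E₁ 1 := le_max_right _ _
  have hW : 1 ≤ max 1 (m (2 * k) s) := le_max_left _ _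
  have hk' : (2 : ℝ) ≤ k := by exact_mod_cast hk
  have hden : (0 : ℝ) < 2 * k - 2 := by linarith
  rcases hp.eq_or_lt with h2 | hp2
  · subst h2
    have e0 : (((2 : ℕ) : ℝ) - 2) / (2 * k - 2) = 0 := by norm_num
    rw [e0, Real.rpow_zero, mul_one]
    exact (hM.energy_le s hs).trans (le_max_left _ _)
  rcases hpk.eq_or_lt with h2k | hpk2
  · subst h2k
    have e1 : (((2 * k : ℕ) : ℝ) - 2) / (2 * k - 2) = 1 := by
      push_cast
      exact div_self hden.ne'
    rw [e1, Real.rpow_one]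
    calc m (2 * k) s ≤ max 1 (m (2 * k) s) := le_max_right _ _
      _ = 1 * max 1 (m (2 * k) s) := (one_mul _).symm
      _ ≤ max E₁ 1 * max 1 (m (2 * k) s) := by gcongr
  · have hly := hM.lyapunov 2 p (2 * k) hp2 hpk2 s hs
    push_cast at hly
    have hpl : (2 : ℝ) < p := by exact_mod_cast hp2
    have hpu : (p : ℝ) < 2 * k := by exact_mod_cast hpk2
    have ha0 : 0 ≤ (2 * (k : ℝ) - p) / (2 * k - 2) := div_nonneg (by linarith) hden.le
    have ha1 : (2 * (k : ℝ) - p) / (2 * k - 2) ≤ 1 := by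
      rw [div_le_one hden]
      linarith
    have hb0 : 0 ≤ ((p : ℝ) - 2) / (2 * k - 2) := div_nonneg (by linarith) hden.le
    have h2 : m 2 s ^ ((2 * (k : ℝ) - p) / (2 * k - 2)) ≤ max E₁ 1 :=
      calc m 2 s ^ ((2 * (k : ℝ) - p) / (2 * k - 2)) ≤ max E₁ 1 ^ ((2 * (k : ℝ) - p) / (2 * k - 2)) :=
            Real.rpow_le_rpow (hM.nonneg 2 s hs) ((hM.energy_le s hs).trans (le_max_left _ _)) ha0
        _ ≤ max E₁ 1 ^ (1 : ℝ) := Real.rpow_le_rpow_of_exponent_le hE ha1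
        _ = max E₁ 1 := Real.rpow_one _
    have h3 : m (2 * k) s ^ (((p : ℝ) - 2) / (2 * k - 2))
        ≤ max 1 (m (2 * k) s) ^ (((p : ℝ) - 2) / (2 * k - 2)) :=
      Real.rpow_le_rpow (hM.nonneg _ s hs) (le_max_right _ _) hb0
    calc m p s ≤ m 2 s ^ ((2 * (k : ℝ) - p) / (2 * k - 2)) * m (2 * k) s ^ (((p : ℝ) - 2) / (2 * k - 2)) := hly
      _ ≤ max E₁ 1 * max 1 (m (2 * k) s) ^ (((p : ℝ) - 2) / (2 * k - 2)) :=
          mul_le_mul h2 h3 (Real.rpow_nonneg (hM.nonneg _ s hs) _) (by positivity)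

/-- **Every moment of order in `[2, 2k]` is at most `E · max(1, m_{2k})`.** [folklore] -/
theorem moment_le_max (hM : MomentSystem t ν n k₁ q K₁ K₂ CG CSD E₁ C₀ A₀ m) {k p : ℕ} (hk : 2 ≤ k)
    (hp : 2 ≤ p) (hpk : p ≤ 2 * k) {s : ℝ} (hs : s ∈ Set.Icc 0 t) :
    m p s ≤ max E₁ 1 * max 1 (m (2 * k) s) := by
  have h := moment_le_interp hM hk hp hpk hs
  have hW : 1 ≤ max 1 (m (2 * k) s) := le_max_left _ _
  have hk' : (2 : ℝ) ≤ k := by exact_mod_cast hk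
  have hden : (0 : ℝ) < 2 * k - 2 := by linarith
  have hpu : (p : ℝ) ≤ 2 * k := by exact_mod_cast hpk
  have hb1 : ((p : ℝ) - 2) / (2 * k - 2) ≤ 1 := by
    rw [div_le_one hden]
    linarith
  calc m p s ≤ _ := h
    _ ≤ max E₁ 1 * max 1 (m (2 * k) s) ^ (1 : ℝ) := by gcongr
    _ = max E₁ 1 * max 1 (m (2 * k) s) := by rw [Real.rpow_one]

/-- **Products of complementary orders are sub-linear.**  If `p, p' ≥ 2` and `p + p' = 2k + 1` then
`m_p(s) m_{p'}(s) ≤ E² · max(1, m_{2k}(s))` (the two interpolation exponents add up to `(2k-3)/(2k-2) ≤ 1`).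
[folklore] -/
theorem moment_mul_moment_le (hM : MomentSystem t ν n k₁ q K₁ K₂ CG CSD E₁ C₀ A₀ m) {k p p' : ℕ}
    (hk : 2 ≤ k) (hp : 2 ≤ p) (hp' : 2 ≤ p') (hpp : p + p' = 2 * k + 1) {s : ℝ} (hs : s ∈ Set.Icc 0 t) :
    m p s * m p' s ≤ max E₁ 1 ^ 2 * max 1 (m (2 * k) s) := by
  have hpk : p ≤ 2 * k := by omega
  have hpk' : p' ≤ 2 * k := by omega
  have h1 := moment_le_interp hM hk hp hpk hs
  have h2 := moment_le_interp hM hk hp' hpk' hs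
  have hW : 1 ≤ max 1 (m (2 * k) s) := le_max_left _ _
  have hW0 : 0 < max 1 (m (2 * k) s) := by positivity
  have hk' : (2 : ℝ) ≤ k := by exact_mod_cast hk
  have hden : (0 : ℝ) < 2 * k - 2 := by linarith
  have hsum : ((p : ℝ) - 2) / (2 * k - 2) + ((p' : ℝ) - 2) / (2 * k - 2) ≤ 1 := by
    rw [← add_div, div_le_one hden]
    have : (p : ℝ) + p' = 2 * k + 1 := by exact_mod_cast hpp
    linarith
  calc m p s * m p' s
        ≤ (max E₁ 1 * max 1 (m (2 * k) s) ^ (((p : ℝ) - 2) / (2 * k - 2))) *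
          (max E₁ 1 * max 1 (m (2 * k) s) ^ (((p' : ℝ) - 2) / (2 * k - 2))) :=
          mul_le_mul h1 h2 (hM.nonneg _ s hs) (by positivity)
    _ = max E₁ 1 ^ 2 * max 1 (m (2 * k) s) ^ (((p : ℝ) - 2) / (2 * k - 2) + ((p' : ℝ) - 2) / (2 * k - 2)) := by
          rw [Real.rpow_add hW0]
          ring
    _ ≤ max E₁ 1 ^ 2 * max 1 (m (2 * k) s) ^ (1 : ℝ) := by gcongr
    _ = max E₁ 1 ^ 2 * max 1 (m (2 * k) s) := by rw [Real.rpow_one]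

/-- **The super-linear loss.**  For `k ≥ 1` and `s ∈ [0,t]`: `m_{2k}(s) · m_{2k}(s)^{1/(2k)} ≤ m_{2k+1}(s)` — Lyapunov
between the orders `0 < 2k < 2k+1` with `m_0 ≤ 1`, raised to the power `(2k+1)/(2k)`. [folklore] -/
theorem moment_mul_rpow_le_moment_succ (hM : MomentSystem t ν n k₁ q K₁ K₂ CG CSD E₁ C₀ A₀ m) {k : ℕ}
    (hk : 1 ≤ k) {s : ℝ} (hs : s ∈ Set.Icc 0 t) :
    m (2 * k) s * m (2 * k) s ^ (1 / (2 * (k : ℝ))) ≤ m (2 * k + 1) s := by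
  have hly := hM.lyapunov 0 (2 * k) (2 * k + 1) (by omega) (by omega) s hs
  push_cast at hly
  have hk' : (1 : ℝ) ≤ k := by exact_mod_cast hk
  have hy : 0 ≤ m (2 * k) s := hM.nonneg _ s hs
  have hz : 0 ≤ m (2 * k + 1) s := hM.nonneg _ s hs
  have e1 : (2 * (k : ℝ) + 1 - 2 * k) / (2 * k + 1 - 0) = 1 / (2 * k + 1) := by ring
  have e2 : (2 * (k : ℝ) - 0) / (2 * k + 1 - 0) = 2 * k / (2 * k + 1) := by ring
  rw [e1, e2] at hly
  have h1 : m 0 s ^ (1 / (2 * (k : ℝ) + 1)) ≤ 1 :=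
    Real.rpow_le_one (hM.nonneg 0 s hs) (hM.mass_le s hs) (by positivity)
  have h2 : m (2 * k) s ≤ m (2 * k + 1) s ^ (2 * (k : ℝ) / (2 * k + 1)) :=
    hly.trans (mul_le_of_le_one_left (Real.rpow_nonneg hz _) h1)
  have h3 := Real.rpow_le_rpow hy h2 (by positivity : 0 ≤ (2 * (k : ℝ) + 1) / (2 * k))
  rw [← Real.rpow_mul hz, show 2 * (k : ℝ) / (2 * k + 1) * ((2 * k + 1) / (2 * k)) = 1 by field_simp,
    Real.rpow_one] at h3
  calc m (2 * k) s * m (2 * k) s ^ (1 / (2 * (k : ℝ))) = m (2 * k) s ^ ((2 * (k : ℝ) + 1) / (2 * k)) := by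
        rw [show (2 * (k : ℝ) + 1) / (2 * k) = 1 + 1 / (2 * k) by field_simp,
          Real.rpow_one_add' hy (by positivity)]
    _ ≤ m (2 * k + 1) s := h3

/-- **Odd orders by their even neighbours.**  `m_{2i+1}(s) ≤ √(m_{2i}(s) · m_{2i+2}(s))`. [folklore] -/
theorem moment_odd_le_sqrt (hM : MomentSystem t ν n k₁ q K₁ K₂ CG CSD E₁ C₀ A₀ m) (i : ℕ) {s : ℝ}
    (hs : s ∈ Set.Icc 0 t) : m (2 * i + 1) s ≤ Real.sqrt (m (2 * i) s * m (2 * i + 2) s) := by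
  have hly := hM.lyapunov (2 * i) (2 * i + 1) (2 * i + 2) (by omega) (by omega) s hs
  push_cast at hly
  have e1 : (2 * (i : ℝ) + 2 - (2 * i + 1)) / (2 * i + 2 - 2 * i) = 1 / 2 := by ring
  have e2 : (2 * (i : ℝ) + 1 - 2 * i) / (2 * i + 2 - 2 * i) = 1 / 2 := by ring
  rw [e1, e2] at hly
  rw [Real.sqrt_eq_rpow, Real.mul_rpow (hM.nonneg _ s hs) (hM.nonneg _ s hs)]
  exact hly

/-! ## §3 The balance integrand above a polynomial threshold -/

/-- **The loss term of the balance.**  For `k ≥ k₁` (so `γ_k = C_SD/(k+1) ≤ 1/2`):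
`(K₁/2) · y · y^{1/(2k)} - K₂ y ≤ (1 - γ_k)(K₁ m_{2k+1} - K₂ y)`, `y = m_{2k}(r)` — the super-linear loss
(`moment_mul_rpow_le_moment_succ`) with `1/2 ≤ 1 - γ_k ≤ 1`. [folklore] -/
theorem loss_lower (hM : MomentSystem t ν n k₁ q K₁ K₂ CG CSD E₁ C₀ A₀ m) (hk₁ : 2 ≤ k₁)
    (hK₁ : 0 < K₁) (hK₂ : 0 ≤ K₂) (hCSD : 0 ≤ CSD) (hCSDk : 2 * CSD ≤ (k₁ : ℝ) + 1)
    {k : ℕ} (hk : k₁ ≤ k) {r : ℝ} (hr : r ∈ Set.Icc 0 t) :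
    K₁ / 2 * (m (2 * k) r * m (2 * k) r ^ (1 / (2 * (k : ℝ)))) - K₂ * m (2 * k) r
      ≤ (1 - CSD / ((k : ℝ) + 1)) * (K₁ * m (2 * k + 1) r - K₂ * m (2 * k) r) := by
  have hkr : (k₁ : ℝ) ≤ k := by exact_mod_cast hk
  have hk0 : (0 : ℝ) < (k : ℝ) + 1 := by positivity
  have hγ0 : 0 ≤ CSD / ((k : ℝ) + 1) := div_nonneg hCSD hk0.le
  have hγ1 : CSD / ((k : ℝ) + 1) ≤ 1 / 2 := by
    rw [div_le_iff₀ hk0]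
    linarith
  have hy : 0 ≤ m (2 * k) r := hM.nonneg _ r hr
  have hz : 0 ≤ m (2 * k + 1) r := hM.nonneg _ r hr
  have hL := moment_mul_rpow_le_moment_succ hM (by omega : 1 ≤ k) hr
  have h1 : K₁ / 2 * (m (2 * k) r * m (2 * k) r ^ (1 / (2 * (k : ℝ)))) ≤ K₁ / 2 * m (2 * k + 1) r := by
    gcongr
  have h2 : K₁ / 2 * m (2 * k + 1) r ≤ (1 - CSD / ((k : ℝ) + 1)) * (K₁ * m (2 * k + 1) r) := by
    have : 0 ≤ K₁ * m (2 * k + 1) r := by positivity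
    nlinarith
  have h3 : (1 - CSD / ((k : ℝ) + 1)) * (K₂ * m (2 * k) r) ≤ K₂ * m (2 * k) r := by
    have : 0 ≤ K₂ * m (2 * k) r := by positivity
    nlinarith
  nlinarith

/-- **Pointwise bound of the Povzner balance integrand at order `k ≥ k₁`.**  With `y = m_{2k}(r)`,
`E = max E₁ 1`, `B_k = ∑_{0<j<k} C(k,j) C_G (1 + min(j,k-j))^q`:
`integrand(r) ≤ B_k E² max(1,y) + K₂ y - (K₁/2) · y · y^{1/(2k)}` — every gain product has complementary orders
(`moment_mul_moment_le`), `γ_k = C_SD/(k+1) ≤ 1/2`, and the loss is super-linear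
(`moment_mul_rpow_le_moment_succ`). [folklore] -/
theorem balance_integrand_le (hM : MomentSystem t ν n k₁ q K₁ K₂ CG CSD E₁ C₀ A₀ m) (hk₁ : 2 ≤ k₁)
    (hK₁ : 0 < K₁) (hK₂ : 0 ≤ K₂) (hCG : 0 ≤ CG) (hCSD : 0 ≤ CSD) (hCSDk : 2 * CSD ≤ (k₁ : ℝ) + 1)
    {k : ℕ} (hk : k₁ ≤ k) {r : ℝ} (hr : r ∈ Set.Icc 0 t) :
    (CSD / ((k : ℝ) + 1) / 2) *
          ∑ j ∈ Finset.Ioo 0 k, (k.choose j : ℝ) * (CG * (1 + (min j (k - j) : ℝ)) ^ q) *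
            (m (2 * j + 1) r * m (2 * (k - j)) r + m (2 * j) r * m (2 * (k - j) + 1) r)
        - (1 - CSD / ((k : ℝ) + 1)) * (K₁ * m (2 * k + 1) r - K₂ * m (2 * k) r)
      ≤ (∑ j ∈ Finset.Ioo 0 k, (k.choose j : ℝ) * (CG * (1 + (min j (k - j) : ℝ)) ^ q)) *
            max E₁ 1 ^ 2 * max 1 (m (2 * k) r)
          + K₂ * m (2 * k) r - K₁ / 2 * (m (2 * k) r * m (2 * k) r ^ (1 / (2 * (k : ℝ)))) := by
  have hk2 : 2 ≤ k := hk₁.trans hk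
  have hkr : (k₁ : ℝ) ≤ k := by exact_mod_cast hk
  have hk0 : (0 : ℝ) < (k : ℝ) + 1 := by positivity
  -- the Povzner constant γ_k = C_SD/(k+1) ∈ [0, 1/2]
  have hγ0 : 0 ≤ CSD / ((k : ℝ) + 1) := div_nonneg hCSD hk0.le
  have hγ1 : CSD / ((k : ℝ) + 1) ≤ 1 / 2 := by
    rw [div_le_iff₀ hk0]
    linarith
  set W := max 1 (m (2 * k) r) with hW
  set E := max E₁ 1 with hE
  -- gain: every product is ≤ E² W
  have hgain : ∑ j ∈ Finset.Ioo 0 k, (k.choose j : ℝ) * (CG * (1 + (min j (k - j) : ℝ)) ^ q) *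
        (m (2 * j + 1) r * m (2 * (k - j)) r + m (2 * j) r * m (2 * (k - j) + 1) r)
      ≤ (∑ j ∈ Finset.Ioo 0 k, (k.choose j : ℝ) * (CG * (1 + (min j (k - j) : ℝ)) ^ q)) * (2 * (E ^ 2 * W)) := by
    rw [Finset.sum_mul]
    refine Finset.sum_le_sum fun j hj => ?_
    rw [Finset.mem_Ioo] at hj
    have hmin : 0 ≤ min (j : ℝ) ((k : ℝ) - j) := by
      rw [le_min_iff]
      constructor
      · positivity
      · have : (j : ℝ) ≤ k := by exact_mod_cast hj.2.le
        linarith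
    have ha : 0 ≤ (k.choose j : ℝ) * (CG * (1 + min (j : ℝ) ((k : ℝ) - j)) ^ q) := by positivity
    have h1 : m (2 * j + 1) r * m (2 * (k - j)) r ≤ E ^ 2 * W :=
      moment_mul_moment_le hM hk2 (by omega) (by omega) (by omega) hr
    have h2 : m (2 * j) r * m (2 * (k - j) + 1) r ≤ E ^ 2 * W :=
      moment_mul_moment_le hM hk2 (by omega) (by omega) (by omega) hr
    calc _ ≤ (k.choose j : ℝ) * (CG * (1 + min (j : ℝ) ((k : ℝ) - j)) ^ q) * (E ^ 2 * W + E ^ 2 * W) := by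
          gcongr
      _ = _ := by ring
  -- loss: (1 - γ)(K₁ m_{2k+1} - K₂ y) ≥ (K₁/2) y^{1+1/(2k)} - K₂ y
  have hloss := loss_lower hM hk₁ hK₁ hK₂ hCSD hCSDk hk hr
  have hB : 0 ≤ (∑ j ∈ Finset.Ioo 0 k, (k.choose j : ℝ) * (CG * (1 + (min j (k - j) : ℝ)) ^ q)) := by
    refine Finset.sum_nonneg fun j hj => ?_
    rw [Finset.mem_Ioo] at hj
    have hmin : 0 ≤ min (j : ℝ) ((k : ℝ) - j) := by
      rw [le_min_iff]
      constructor
      · positivity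
      · have : (j : ℝ) ≤ k := by exact_mod_cast hj.2.le
        linarith
    positivity
  have hEW : 0 ≤ E ^ 2 * W := by positivity
  set B := ∑ j ∈ Finset.Ioo 0 k, (k.choose j : ℝ) * (CG * (1 + (min j (k - j) : ℝ)) ^ q) with hBdef
  set S := ∑ j ∈ Finset.Ioo 0 k, (k.choose j : ℝ) * (CG * (1 + (min j (k - j) : ℝ)) ^ q) *
        (m (2 * j + 1) r * m (2 * (k - j)) r + m (2 * j) r * m (2 * (k - j) + 1) r) with hSdef
  have hgain' : CSD / ((k : ℝ) + 1) / 2 * S ≤ B * E ^ 2 * W := by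
    calc CSD / ((k : ℝ) + 1) / 2 * S ≤ CSD / ((k : ℝ) + 1) / 2 * (B * (2 * (E ^ 2 * W))) := by gcongr
      _ = CSD / ((k : ℝ) + 1) * (B * (E ^ 2 * W)) := by ring
      _ ≤ 1 * (B * (E ^ 2 * W)) := by gcongr; linarith
      _ = B * E ^ 2 * W := by ring
  linarith

/-! ## §4 The polynomial bounds (registered stub `gevreyPolynomialBounds`) -/

/-- **Desvillettes' polynomial moment bounds, uniform in the horizon, the frequency scale and the truncation.**
For admissible constants there is an explicit `D : ℕ → ℝ` (depending on `k₁, q, K₁, K₂, C_G, C_SD, E₁, C₀, A₀`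
only) such that every `MomentSystem t ν n k₁ q …` with `ν > 0`, `k₁ ≤ n` has `m_{2k}(s) ≤ D k` for all
`k ≤ n`, `s ∈ [0,t]`.  For `k₁ ≤ k ≤ n` this is the maximum principle at the level
`D₀ k = max (max 1 (C₀ A₀ᵏ k!)) ((2(B_k E² + K₂)/K₁)^{2k})` (above it the super-linear loss beats the linear
gain, `balance_integrand_le`); below `k₁` interpolate against `m_{2k₁}` (`moment_le_max`); the witness is
`D k = E · max 1 (D₀ (max k k₁))`. [folklore] -/
theorem gevreyPolynomialBounds : ∀ (k₁ q : ℕ) (K₁ K₂ CG CSD E₁ C₀ A₀ : ℝ), 2 ≤ k₁ → 0 < K₁ → 0 ≤ K₂ → 0 ≤ CG → 0 ≤ CSD → 2 * CSD ≤ (k₁ : ℝ) + 1 → ∃ D : ℕ → ℝ, ∀ (t ν : ℝ) (n : ℕ) (m : ℕ → ℝ → ℝ), 0 < ν → k₁ ≤ n → Summit.AtomisticToContinuum.HydrodynamicLimit.Theorems.SuperExponentialEnergyTailsLine.MomentSystem t ν n k₁ q K₁ K₂ CG CSD E₁ C₀ A₀ m → ∀ k : ℕ, k ≤ n → ∀ s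 ∈ Set.Icc 0 t, m (2 * k) s ≤ D k := by
  intro k₁ q K₁ K₂ CG CSD E₁ C₀ A₀ hk₁ hK₁ hK₂ hCG hCSD hCSDk
  set E : ℝ := max E₁ 1 with hE
  set B : ℕ → ℝ := fun k =>
    ∑ j ∈ Finset.Ioo 0 k, (k.choose j : ℝ) * (CG * (1 + (min j (k - j) : ℝ)) ^ q) with hB
  set D₀ : ℕ → ℝ := fun k =>
    max (max 1 (C₀ * A₀ ^ k * (k.factorial : ℝ))) ((2 * (B k * E ^ 2 + K₂) / K₁) ^ (2 * k)) with hD₀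
  refine ⟨fun k => E * max 1 (D₀ (max k k₁)), ?_⟩
  intro t ν n m hν hn hM
  have hE1 : 1 ≤ E := le_max_right _ _
  -- the orders k₁ ≤ k ≤ n: maximum principle at the level D₀ k
  have hA : ∀ k, k₁ ≤ k → k ≤ n → ∀ s ∈ Set.Icc 0 t, m (2 * k) s ≤ D₀ k := by
    intro k hk hkn
    have hk2 : 2 ≤ k := hk₁.trans hk
    have hkpos : (0 : ℝ) < 2 * k := by positivity
    have hB0 : 0 ≤ B k := by
      refine Finset.sum_nonneg fun j hj => ?_
      rw [Finset.mem_Ioo] at hj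
      have hmin : 0 ≤ min (j : ℝ) ((k : ℝ) - j) := by
        rw [le_min_iff]
        constructor
        · positivity
        · have : (j : ℝ) ≤ k := by exact_mod_cast hj.2.le
          linarith
      positivity
    set β : ℝ := 2 * (B k * E ^ 2 + K₂) / K₁ with hβ
    have hβ0 : 0 ≤ β := by positivity
    have hD1 : 1 ≤ D₀ k := le_trans (le_max_left _ _) (le_max_left _ _)
    refine gevreyMaxPrinciple t ν (D₀ k) (m (2 * k)) _ hν.le (hM.continuousOn _) ?_ ?_
      (hM.balance k hk hkn)
    · exact (hM.initial k).trans ((le_max_right _ _).trans (le_max_left _ _))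
    · intro r hr hlt
      have hI := balance_integrand_le hM hk₁ hK₁ hK₂ hCG hCSD hCSDk hk hr
      set y := m (2 * k) r with hy
      have hy1 : 1 ≤ y := hD1.trans hlt.le
      have hy0 : 0 ≤ y := zero_le_one.trans hy1
      have hW : max 1 y = y := max_eq_right hy1
      -- y^{1/(2k)} ≥ β
      have hroot : β ≤ y ^ (1 / (2 * (k : ℝ))) := by
        have hβy : β ^ (2 * k) ≤ y := le_trans (le_max_right _ _) hlt.le
        have e : (1 / (2 * (k : ℝ))) = (((2 * k : ℕ) : ℝ))⁻¹ := by
          push_cast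
          ring
        calc β = (β ^ (2 * k)) ^ (((2 * k : ℕ) : ℝ))⁻¹ :=
              (Real.pow_rpow_inv_natCast hβ0 (by omega)).symm
          _ ≤ y ^ (((2 * k : ℕ) : ℝ))⁻¹ := Real.rpow_le_rpow (by positivity) hβy (by positivity)
          _ = y ^ (1 / (2 * (k : ℝ))) := by rw [e]
      have hkey : (B k * E ^ 2 + K₂) * y ≤ K₁ / 2 * (y * y ^ (1 / (2 * (k : ℝ)))) := by
        calc (B k * E ^ 2 + K₂) * y = K₁ / 2 * (y * β) := by
              rw [hβ]
              field_simp
          _ ≤ K₁ / 2 * (y * y ^ (1 / (2 * (k : ℝ)))) := by gcongr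
      rw [hW] at hI
      show _ ≤ (0 : ℝ)
      nlinarith
  -- all orders k ≤ n
  intro k hkn s hs
  have hk₁n := hA k₁ le_rfl hn s hs
  show m (2 * k) s ≤ E * max 1 (D₀ (max k k₁))
  rcases le_or_gt k₁ k with hk | hk
  · rw [max_eq_left hk]
    calc m (2 * k) s ≤ D₀ k := hA k hk hkn s hs
      _ ≤ max 1 (D₀ k) := le_max_right _ _
      _ = 1 * max 1 (D₀ k) := (one_mul _).symm
      _ ≤ E * max 1 (D₀ k) := by gcongr
  · rw [max_eq_right hk.le]
    rcases Nat.eq_zero_or_pos k with h0 | hpos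
    · subst h0
      calc m (2 * 0) s = m 0 s := by norm_num
        _ ≤ 1 := hM.mass_le s hs
        _ ≤ E * 1 := by linarith
        _ ≤ E * max 1 (D₀ k₁) := by gcongr; exact le_max_left _ _
    · calc m (2 * k) s ≤ E * max 1 (m (2 * k₁) s) := moment_le_max hM hk₁ (by omega) (by omega) hs
        _ ≤ E * max 1 (D₀ k₁) := by gcongr

end Summit.AtomisticToContinuum.HydrodynamicLimit.Theorems.SuperExponentialEnergyTailsMaxPrinciple

end
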